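import Literature.AlgebraicGeometry.ComplexMultiplication.CyclotomicFermatCMTypesThreePrimeLevelMaximum
import HarnessLib

/-!
# Koblitz–Rohrlich, REMARK 1 "`3/20` is the maximum for `s(N)` (attained only when `N = 55`)" at three-prime levels: the STRICT bound
# `40·#S₀(N) < 3·φ(N)` (`s(N) < 3/20`) for `N = pᵃqᵇrᶜ`

Layer `Literature/AlgebraicGeometry/ComplexMultiplication`, namespace `…ComplexMultiplication.CyclotomicFermatCMType`; sequel of
`CyclotomicFermatCMTypesThreePrimeLevelMaximum` (`40·#S₀(N) ≤ 3·φ(N)` at three-prime levels, K–R's printed "Thus `s(N) ≤ 3/20`") and, through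
it, `CyclotomicFermatCMTypesTwoPrimeLevelMaximum` (`ω(N) ≤ 2`: `<` iff `N ≠ 55`).  THEOREMS ONLY (no definition, no named fact, no `sorry`).

THE SOURCE.  N. Koblitz, D. Rohrlich, *Simple factors in the Jacobian of a Fermat curve*, Canad. J. Math. **30** (1978) 1183–1205, §2, proof
of the Proposition (p. 1191): "(1) `ordᵢ ≥ m + 1 − i`. Also, (2) `ordₘ = 1` only if `pₘ ≥ 2 + ∏_{i<m} pᵢ`. … Case 2. `m = 3`. … `(pᵢ − 1)ordᵢ ≥ 20`.
Thus `s(N) ≤ 3/20 < 1/6`" and REMARK 1 (p. 1192): "the lower value `3/20` does occur, when `N = 55` … It is clear from the above proof that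
`3/20` is the maximum for `s(N)` (attained only when `N = 55`), if we exclude the possibility `s(N) = 1/6`."

WHAT IS PROVED — the words "attained only when `N = 55`" at three-prime levels, i.e. that the three per-prime bounds `(pᵢ − 1)ordᵢ ≥ 20` are
never simultaneously sharp: for the LARGEST prime `p` of `N` (so `p ≥ 11`) one has `(p − 1)·ord > 20` (`twenty_lt_sub_one_mul_orderOf_of_lt`:
`ord ≥ 3` gives `≥ 30`; `ord = 2` gives `> 20` unless `p = 11`, and `11² − 1 = 120` is not divisible by two distinct primes `≥ 5`; `ord = 1`
forces `qr ∣ p − 1`, so `p − 1 ≥ 25`), hence `40·T_p < φ(pᵃ)·φ(N_p)` for that prime (`forty_mul_card_lt_of_lt`), hence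
**`forty_mul_sum_card_lt_three_primes`** (`40·Σ_ℓ T_ℓ < 3·φ(N)`), **`forty_mul_card_bad_lt_three_primes`** (`40·#S₀(N) < 3·φ(N)`),
`s_lt_three_div_twenty_three_primes` (`s(N) < 3/20`) and `s_lt_s_fiftyFive_three_primes` (`s(N) < s(55)`) for every `N = pᵃqᵇrᶜ` with
distinct primes `p, q, r ≥ 5`, `a, b, c ≥ 1`.  With the siblings: at every level prime to `6` with `ω(N) ≤ 3`, `s(N) ≤ 3/20` with equality
iff `N = 55`.

## Honest column / NOT here

* K–R do not spell out the strictness argument ("It is clear from the above proof"); the case analysis for the largest prime is ours, using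
  only their (1), (2) and Table 1's entry `11² − 1 = 120 = 2³·3·5`.
* `ω(N) ≥ 4` is NOT typed (K–R's printed Case 3 bound `1/36 + 1/30 + 1/20 + 1/24 = 55/360` exceeds `3/20 = 54/360`, so the maximum at
  `m = 4` needs an argument beyond the printed one); the assembled "`ω(N) ≤ 3`" statement over `N.primeFactors.card` is not written out
  (the three cases are the siblings' `s_primePow_eq_zero`, `forty_mul_card_bad_lt_iff_twoPrimes` and this file).
* Private: copies of the siblings' `dvd_pow_orderOf_sub_one`, `card_level_congr`, `ordCompl_pow_mul_of_not_dvd`, and the `p`-largest helper.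

## References

* [KoblitzRohrlich1978] N. Koblitz, D. Rohrlich, Canad. J. Math. 30 (1978) 1183–1205: §2 Proposition, (1), (2), Table 1, Case 2 (pp. 1190–1191),
  Remark 1 (p. 1192).

## Provenance

Cell `pub-hodgecm2` (COR-CM), literature seat `lit-deligne-3` gen 35 (claim KR78-MAXIMUM-3-STRICT; count-neutral, own lane).
-/

noncomputable section

open NumberField

namespace Literature.AlgebraicGeometry.ComplexMultiplication

open Literature.NumberTheory.ComplexMultiplication
open Literature.NumberTheory.LFunctions

namespace CyclotomicFermatCMType

/-! ## §1 The largest prime: `(p − 1)·ord > 20`, so `40·T_p < φ(pᵃ)·φ(N_p)` -/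

section Largest

variable {M : ℕ} [NeZero M]

/-- `M ∣ m^{ord(m)} − 1` for `m` prime to `M` (private copy of the siblings'). [folklore] -/
private theorem dvd_pow_orderOf_sub_one₄ {m : ℕ} (hm : m.Coprime M) :
    M ∣ m ^ orderOf (ZMod.unitOfCoprime m hm) - 1 := by
  have hu : ((m : ZMod M)) ^ orderOf (ZMod.unitOfCoprime m hm) = 1 := by
    rw [← ZMod.coe_unitOfCoprime m hm, ← Units.val_pow_eq_pow_val, pow_orderOf_eq_one, Units.val_one]
  rcases Nat.eq_zero_or_pos m with h0 | hpos
  · subst h0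
    have hM : M = 1 := (Nat.coprime_zero_left _).1 hm
    subst hM
    exact one_dvd _
  have h1 : 1 ≤ m ^ orderOf (ZMod.unitOfCoprime m hm) := Nat.one_le_pow _ _ hpos
  have h : ((m ^ orderOf (ZMod.unitOfCoprime m hm) - 1 : ℕ) : ZMod M) = 0 := by
    rw [Nat.cast_sub h1, Nat.cast_pow, Nat.cast_one, hu, sub_self]
  exact (ZMod.natCast_eq_zero_iff _ _).1 h

omit [NeZero M] in
/-- Table 1, the entry `11² − 1 = 120 = 2³·3·5`: a prime `≥ 5` dividing `120` is `5`. [cite: KoblitzRohrlich1978, §2 Table 1 (p. 1190)] -/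
private theorem eq_five_of_dvd_hundredTwenty {s : ℕ} (hs : s.Prime) (h5 : 5 ≤ s) (h : s ∣ 120) : s = 5 := by
  have h' : s ∣ 2 ^ 3 * (3 * 5) := by norm_num; exact h
  rcases (Nat.Prime.dvd_mul hs).1 h' with h2 | h35
  · have := (Nat.prime_dvd_prime_iff_eq hs Nat.prime_two).1 (hs.dvd_of_dvd_pow h2)
    omega
  · rcases (Nat.Prime.dvd_mul hs).1 h35 with h3 | h5'
    · have := (Nat.prime_dvd_prime_iff_eq hs Nat.prime_three).1 h3
      omega
    · exact (Nat.prime_dvd_prime_iff_eq hs (by norm_num)).1 h5'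

/-- **For the LARGEST prime the bound `(p − 1)·ord ≥ 20` is strict**: if `p` is a prime exceeding two distinct primes `q, r ≥ 5` dividing `M`
(`p` prime to `M`), then `20 < (p − 1)·ord`, `ord` the order of `p` modulo `M` — by (1)–(2): `ord ≥ 3` gives `≥ 30` (`p ≥ 11`); `ord = 2`
gives `2(p − 1) > 20` unless `p = 11`, where `M ∣ 120` would need two distinct primes `≥ 5` dividing `120`; `ord = 1` gives `qr ∣ p − 1`.
[cite: KoblitzRohrlich1978, §2 Proposition, (1)–(2) and Case 2 (p. 1191)] -/
theorem twenty_lt_sub_one_mul_orderOf_of_lt {p q r : ℕ} (hp : p.Prime) (hpM : p.Coprime M) (hq : q.Prime) (hr : r.Prime)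
    (hq5 : 5 ≤ q) (hr5 : 5 ≤ r) (hqr : q ≠ r) (hqp : q < p) (hrp : r < p) (hqM : q ∣ M) (hrM : r ∣ M) :
    20 < (p - 1) * orderOf (ZMod.unitOfCoprime p hpM) := by
  obtain ⟨d, hd⟩ : ∃ d, orderOf (ZMod.unitOfCoprime p hpM) = d := ⟨_, rfl⟩
  have hMd : M ∣ p ^ d - 1 := by
    have h := dvd_pow_orderOf_sub_one₄ hpM
    rwa [hd] at h
  have hd0 : 0 < d := by
    rw [← hd]
    exact orderOf_pos _
  rw [hd]
  -- `p ≥ 11`: `p` exceeds two distinct primes `≥ 5`, one of which is `≥ 7`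
  have hp11 : 11 ≤ p := by
    have h7 : 7 ≤ q ∨ 7 ≤ r := by
      by_contra h
      push Not at h
      have hq' : q = 5 ∨ q = 6 := by omega
      have hr' : r = 5 ∨ r = 6 := by omega
      rcases hq' with rfl | rfl <;> rcases hr' with rfl | rfl
      · exact hqr rfl
      · exact absurd hr (by decide)
      · exact absurd hq (by decide)
      · exact hqr rfl
    have hp8 : 8 ≤ p := by omega
    by_contra hlt
    interval_cases p
    · exact absurd hp (by decide)
    · exact absurd hp (by decide)
    · exact absurd hp (by decide)
  by_cases hd3 : 3 ≤ d
  · calc 20 < 10 * 3 := by norm_num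
      _ ≤ (p - 1) * d := Nat.mul_le_mul (by omega) hd3
  by_cases hd2 : d = 2
  · subst hd2
    by_cases hp13 : 13 ≤ p
    · calc 20 < 12 * 2 := by norm_num
        _ ≤ (p - 1) * 2 := Nat.mul_le_mul_right _ (by omega)
    · -- `p ∈ {11, 12}`, `p` prime: `p = 11`, `M ∣ 120`
      exfalso
      have hp11' : p = 11 := by
        interval_cases p
        · rfl
        · exact absurd hp (by decide)
      subst hp11'
      have h120 : M ∣ 120 := by norm_num at hMd; exact hMd
      exact hqr ((eq_five_of_dvd_hundredTwenty hq hq5 (dvd_trans hqM h120)).trans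
        (eq_five_of_dvd_hundredTwenty hr hr5 (dvd_trans hrM h120)).symm)
  · have hd1 : d = 1 := by omega
    subst hd1
    rw [pow_one] at hMd
    have hqr' : q * r ∣ p - 1 :=
      Nat.Coprime.mul_dvd_of_dvd_of_dvd ((Nat.coprime_primes hq hr).2 hqr) (dvd_trans hqM hMd) (dvd_trans hrM hMd)
    have h25 : 25 ≤ q * r := Nat.mul_le_mul hq5 hr5
    have hle : q * r ≤ p - 1 := Nat.le_of_dvd (by omega) hqr'
    rw [mul_one]
    omega

/-- **The per-prime bound is STRICT for the largest prime**: with `T = #{ψ mod M odd : ψ(p) = 1}`, `M` prime to `p` and divisible by two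
distinct primes `q, r ≥ 5` smaller than `p`, and `a ≥ 1`: `40·T < φ(pᵃ)·φ(M)` (from `2·ord·T ≤ φ(M)` and `(p − 1)·ord > 20`; `T = 0` is
trivially strict). [cite: KoblitzRohrlich1978, §2 Proposition, Case 2 (p. 1191) and Remark 1 (p. 1192)] -/
theorem forty_mul_card_lt_of_lt {p q r a : ℕ} (hp : p.Prime) (hpM : p.Coprime M) (hq : q.Prime) (hr : r.Prime)
    (hq5 : 5 ≤ q) (hr5 : 5 ≤ r) (hqr : q ≠ r) (hqp : q < p) (hrp : r < p) (hqM : q ∣ M) (hrM : r ∣ M) (ha : a ≠ 0) :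
    40 * Nat.card {ψ : DirichletCharacter ℂ M // ψ.Odd ∧ ψ (p : ZMod M) = 1} < (p ^ a).totient * M.totient := by
  have hT : Nat.card {ψ : DirichletCharacter ℂ M // ψ.Odd ∧ ψ (p : ZMod M) = 1} =
      Nat.card {ψ : DirichletCharacter ℂ M // ψ.Odd ∧ ψ (ZMod.unitOfCoprime p hpM) = 1} := by
    refine Nat.card_congr (Equiv.subtypeEquivRight fun ψ => ?_)
    rw [ZMod.coe_unitOfCoprime]
  rw [hT]
  set T := Nat.card {ψ : DirichletCharacter ℂ M // ψ.Odd ∧ ψ (ZMod.unitOfCoprime p hpM) = 1}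
  set d := orderOf (ZMod.unitOfCoprime p hpM)
  have h2 : 2 * d * T ≤ M.totient := two_mul_orderOf_mul_card_odd_apply_eq_one_le _
  have h20 : 20 < (p - 1) * d := twenty_lt_sub_one_mul_orderOf_of_lt hp hpM hq hr hq5 hr5 hqr hqp hrp hqM hrM
  have hΦ : p - 1 ≤ (p ^ a).totient := by
    rw [Nat.totient_prime_pow hp (Nat.pos_of_ne_zero ha)]
    calc p - 1 = 1 * (p - 1) := (one_mul _).symm
      _ ≤ p ^ (a - 1) * (p - 1) := Nat.mul_le_mul_right _ (Nat.one_le_pow _ _ hp.pos)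
  have hφpos : 0 < (p ^ a).totient * M.totient :=
    Nat.mul_pos (Nat.totient_pos.2 (pow_pos hp.pos a)) (Nat.totient_pos.2 (NeZero.pos M))
  rcases Nat.eq_zero_or_pos T with hT0 | hTpos
  · rw [hT0, mul_zero]
    exact hφpos
  calc 40 * T = 2 * 20 * T := by ring
    _ < 2 * ((p - 1) * d) * T := Nat.mul_lt_mul_of_pos_right (Nat.mul_lt_mul_of_pos_left h20 (by norm_num)) hTpos
    _ = (p - 1) * (2 * d * T) := by ring
    _ ≤ (p - 1) * M.totient := Nat.mul_le_mul_left _ h2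
    _ ≤ (p ^ a).totient * M.totient := Nat.mul_le_mul_right _ hΦ

end Largest

/-! ## §2 Three-prime levels: `40·Σ T_ℓ < 3·φ(N)`, `40·#S₀(N) < 3·φ(N)`, `s(N) < 3/20 = s(55)` -/

section ThreePrimes

/-- Transport of the side count along an equality of moduli (private copy of the siblings'). [folklore] -/
private theorem card_level_congr₄ (r : ℕ) {M M' : ℕ} (h : M = M') :
    Nat.card {ψ : DirichletCharacter ℂ M // ψ.Odd ∧ ψ (r : ZMod M) = 1} =
      Nat.card {ψ : DirichletCharacter ℂ M' // ψ.Odd ∧ ψ (r : ZMod M') = 1} := by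
  subst h
  rfl

/-- `ordCompl[p] (pᵃ·M) = M` for `p ∤ M` (private copy of the sibling's). [folklore] -/
private theorem ordCompl_pow_mul_of_not_dvd₄ {p a M : ℕ} (hp : p.Prime) (hM : ¬p ∣ M) : ordCompl[p] (p ^ a * M) = M := by
  rw [Nat.ordCompl_self_pow_mul M a hp, (Nat.ordCompl_eq_self_iff_zero_or_not_dvd _ hp).2 (Or.inr hM)]

/-- The strict sum bound when `p` is the largest of the three primes (the `p`-summand is strict, the other two are the sibling's
`forty_mul_card_le`). [cite: KoblitzRohrlich1978, §2 Proposition, Case 2 (p. 1191) and Remark 1 (p. 1192)] -/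
private theorem forty_mul_sum_card_lt_of_largest {p q r a b c : ℕ} (hp : p.Prime) (hq : q.Prime) (hr : r.Prime)
    (hp5 : 5 ≤ p) (hq5 : 5 ≤ q) (hr5 : 5 ≤ r) (hpq : p ≠ q) (hpr : p ≠ r) (hqr : q ≠ r) (hqp : q < p) (hrp : r < p)
    (ha : a ≠ 0) (hb : b ≠ 0) (hc : c ≠ 0) :
    40 * ∑ ℓ ∈ (p ^ a * q ^ b * r ^ c).primeFactors,
        Nat.card {ψ : DirichletCharacter ℂ (ordCompl[ℓ] (p ^ a * q ^ b * r ^ c)) //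
          ψ.Odd ∧ ψ (ℓ : ZMod (ordCompl[ℓ] (p ^ a * q ^ b * r ^ c))) = 1} < 3 * (p ^ a * q ^ b * r ^ c).totient := by
  -- coprimalities
  have cpq : p.Coprime q := (Nat.coprime_primes hp hq).2 hpq
  have cpr : p.Coprime r := (Nat.coprime_primes hp hr).2 hpr
  have cqr : q.Coprime r := (Nat.coprime_primes hq hr).2 hqr
  haveI : NeZero (q ^ b * r ^ c) := ⟨Nat.pos_iff_ne_zero.1 (Nat.mul_pos (pow_pos hq.pos b) (pow_pos hr.pos c))⟩
  haveI : NeZero (p ^ a * r ^ c) := ⟨Nat.pos_iff_ne_zero.1 (Nat.mul_pos (pow_pos hp.pos a) (pow_pos hr.pos c))⟩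
  haveI : NeZero (p ^ a * q ^ b) := ⟨Nat.pos_iff_ne_zero.1 (Nat.mul_pos (pow_pos hp.pos a) (pow_pos hq.pos b))⟩
  -- prime factors and complementary parts
  have hpf : (p ^ a * q ^ b * r ^ c).primeFactors = {p, q, r} := by
    have hA : (p ^ a * q ^ b).Coprime (r ^ c) :=
      Nat.Coprime.mul_left ((cpr.pow_right c).pow_left a) ((cqr.pow_right c).pow_left b)
    rw [Nat.Coprime.primeFactors_mul hA, Nat.Coprime.primeFactors_mul ((cpq.pow_right b).pow_left a),
      Nat.primeFactors_prime_pow ha hp, Nat.primeFactors_prime_pow hb hq, Nat.primeFactors_prime_pow hc hr]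
    ext x
    simp
  have hnp : ¬p ∣ q ^ b * r ^ c := fun h => by
    rcases (Nat.Prime.dvd_mul hp).1 h with h1 | h1
    · exact hpq ((Nat.prime_dvd_prime_iff_eq hp hq).1 (hp.dvd_of_dvd_pow h1))
    · exact hpr ((Nat.prime_dvd_prime_iff_eq hp hr).1 (hp.dvd_of_dvd_pow h1))
  have hnq : ¬q ∣ p ^ a * r ^ c := fun h => by
    rcases (Nat.Prime.dvd_mul hq).1 h with h1 | h1
    · exact hpq.symm ((Nat.prime_dvd_prime_iff_eq hq hp).1 (hq.dvd_of_dvd_pow h1))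
    · exact hqr ((Nat.prime_dvd_prime_iff_eq hq hr).1 (hq.dvd_of_dvd_pow h1))
  have hnr : ¬r ∣ p ^ a * q ^ b := fun h => by
    rcases (Nat.Prime.dvd_mul hr).1 h with h1 | h1
    · exact hpr.symm ((Nat.prime_dvd_prime_iff_eq hr hp).1 (hr.dvd_of_dvd_pow h1))
    · exact hqr.symm ((Nat.prime_dvd_prime_iff_eq hr hq).1 (hr.dvd_of_dvd_pow h1))
  have h1 : ordCompl[p] (p ^ a * q ^ b * r ^ c) = q ^ b * r ^ c := by
    rw [mul_assoc]
    exact ordCompl_pow_mul_of_not_dvd₄ hp hnp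
  have h2 : ordCompl[q] (p ^ a * q ^ b * r ^ c) = p ^ a * r ^ c := by
    rw [show p ^ a * q ^ b * r ^ c = q ^ b * (p ^ a * r ^ c) by ring]
    exact ordCompl_pow_mul_of_not_dvd₄ hq hnq
  have h3 : ordCompl[r] (p ^ a * q ^ b * r ^ c) = p ^ a * q ^ b := by
    rw [show p ^ a * q ^ b * r ^ c = r ^ c * (p ^ a * q ^ b) by ring]
    exact ordCompl_pow_mul_of_not_dvd₄ hr hnr
  -- the strict bound for `p` and the sibling's bounds for `q`, `r`
  have hTp := forty_mul_card_lt_of_lt (M := q ^ b * r ^ c) hp ((hp.coprime_iff_not_dvd).2 hnp) hq hr hq5 hr5 hqr hqp hrp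
    (dvd_mul_of_dvd_left (dvd_pow_self q hb) _) (dvd_mul_of_dvd_right (dvd_pow_self r hc) _) ha
  have hTq := forty_mul_card_le (M := p ^ a * r ^ c) hq hq5 ((hq.coprime_iff_not_dvd).2 hnq) hp hr hp5 hr5 hpr
    (dvd_mul_of_dvd_left (dvd_pow_self p ha) _) (dvd_mul_of_dvd_right (dvd_pow_self r hc) _) hb
  have hTr := forty_mul_card_le (M := p ^ a * q ^ b) hr hr5 ((hr.coprime_iff_not_dvd).2 hnr) hp hq hp5 hq5 hpq
    (dvd_mul_of_dvd_left (dvd_pow_self p ha) _) (dvd_mul_of_dvd_right (dvd_pow_self q hb) _) hc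
  -- the totient of `N` in the three splittings
  have hφ1 : (p ^ a * q ^ b * r ^ c).totient = (p ^ a).totient * (q ^ b * r ^ c).totient := by
    rw [mul_assoc, Nat.totient_mul (Nat.Coprime.mul_right ((cpq.pow_right b).pow_left a) ((cpr.pow_right c).pow_left a))]
  have hφ2 : (p ^ a * q ^ b * r ^ c).totient = (q ^ b).totient * (p ^ a * r ^ c).totient := by
    rw [show p ^ a * q ^ b * r ^ c = q ^ b * (p ^ a * r ^ c) by ring,
      Nat.totient_mul (Nat.Coprime.mul_right ((cpq.symm.pow_right a).pow_left b) ((cqr.pow_right c).pow_left b))]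
  have hφ3 : (p ^ a * q ^ b * r ^ c).totient = (r ^ c).totient * (p ^ a * q ^ b).totient := by
    rw [show p ^ a * q ^ b * r ^ c = r ^ c * (p ^ a * q ^ b) by ring,
      Nat.totient_mul (Nat.Coprime.mul_right ((cpr.symm.pow_right a).pow_left c) ((cqr.symm.pow_right b).pow_left c))]
  have hmem1 : p ∉ ({q, r} : Finset ℕ) := by simp [hpq, hpr]
  have hmem2 : q ∉ ({r} : Finset ℕ) := by simp [hqr]
  rw [hpf, Finset.sum_insert hmem1, Finset.sum_insert hmem2, Finset.sum_singleton, card_level_congr₄ p h1,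
    card_level_congr₄ q h2, card_level_congr₄ r h3]
  rw [← hφ1] at hTp
  rw [← hφ2] at hTq
  rw [← hφ3] at hTr
  omega

/-- **REMARK 1 "attained only when `N = 55`" at three-prime levels, structural form**: for `N = pᵃqᵇrᶜ` with distinct primes `p, q, r ≥ 5`
and `a, b, c ≥ 1`, `40·Σ_{ℓ ∣ N} #{ψ mod N_ℓ odd : ψ(ℓ) = 1} < 3·φ(N)` — STRICT (the summand of the largest prime is strict).
[cite: KoblitzRohrlich1978, §2 Proposition, Case 2 (p. 1191) and Remark 1 (p. 1192)] -/
theorem forty_mul_sum_card_lt_three_primes {p q r a b c N : ℕ} (hp : p.Prime) (hq : q.Prime) (hr : r.Prime)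
    (hp5 : 5 ≤ p) (hq5 : 5 ≤ q) (hr5 : 5 ≤ r) (hpq : p ≠ q) (hpr : p ≠ r) (hqr : q ≠ r) (ha : a ≠ 0) (hb : b ≠ 0) (hc : c ≠ 0)
    (hN : N = p ^ a * q ^ b * r ^ c) :
    40 * ∑ ℓ ∈ N.primeFactors,
        Nat.card {ψ : DirichletCharacter ℂ (ordCompl[ℓ] N) // ψ.Odd ∧ ψ (ℓ : ZMod (ordCompl[ℓ] N)) = 1} < 3 * N.totient := by
  subst hN
  -- one of the three distinct primes is the largest
  rcases Nat.lt_or_gt_of_ne hpq with hpq' | hqp'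
  · rcases Nat.lt_or_gt_of_ne hqr with hqr' | hrq'
    · -- `r` largest
      rw [show p ^ a * q ^ b * r ^ c = r ^ c * p ^ a * q ^ b by ring]
      exact forty_mul_sum_card_lt_of_largest hr hp hq hr5 hp5 hq5 hpr.symm hqr.symm hpq (lt_trans hpq' hqr') hqr' hc ha hb
    · -- `q` largest
      rw [show p ^ a * q ^ b * r ^ c = q ^ b * p ^ a * r ^ c by ring]
      exact forty_mul_sum_card_lt_of_largest hq hp hr hq5 hp5 hr5 hpq.symm hqr hpr hpq' hrq' hb ha hc
  · rcases Nat.lt_or_gt_of_ne hpr with hpr' | hrp'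
    · -- `r` largest
      rw [show p ^ a * q ^ b * r ^ c = r ^ c * p ^ a * q ^ b by ring]
      exact forty_mul_sum_card_lt_of_largest hr hp hq hr5 hp5 hq5 hpr.symm hqr.symm hpq hpr' (lt_trans hqp' hpr') hc ha hb
    · -- `p` largest
      exact forty_mul_sum_card_lt_of_largest hp hq hr hp5 hq5 hr5 hpq hpr hqr hqp' hrp' ha hb hc

variable {p q r a b c N : ℕ} [NeZero N]

/-- **`40·#S₀(N) < 3·φ(N)` at three-prime levels** (`s(N) < 3/20` strictly for `N = pᵃqᵇrᶜ`, distinct primes `≥ 5`, `a, b, c ≥ 1`): Remark 1's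
"attained only when `N = 55`" for `ω(N) = 3`. [cite: KoblitzRohrlich1978, §2 Remark 1 (p. 1192) and Proposition, Case 2 (p. 1191)] -/
theorem forty_mul_card_bad_lt_three_primes (hp : p.Prime) (hq : q.Prime) (hr : r.Prime) (hp5 : 5 ≤ p) (hq5 : 5 ≤ q) (hr5 : 5 ≤ r)
    (hpq : p ≠ q) (hpr : p ≠ r) (hqr : q ≠ r) (ha : a ≠ 0) (hb : b ≠ 0) (hc : c ≠ 0) (hN : N = p ^ a * q ^ b * r ^ c) :
    40 * Nat.card {χ : DirichletCharacter ℂ N // χ.Odd ∧ bernoulliOneChar χ = 0} < 3 * N.totient :=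
  lt_of_le_of_lt (Nat.mul_le_mul_left _ card_odd_bernoulliOneChar_eq_zero_le)
    (forty_mul_sum_card_lt_three_primes hp hq hr hp5 hq5 hr5 hpq hpr hqr ha hb hc hN)

/-- **`s(N) < 3/20` at three-prime levels**, as a rational number. [cite: KoblitzRohrlich1978, §2 Remark 1 (p. 1192)] -/
theorem s_lt_three_div_twenty_three_primes (hp : p.Prime) (hq : q.Prime) (hr : r.Prime) (hp5 : 5 ≤ p) (hq5 : 5 ≤ q) (hr5 : 5 ≤ r)
    (hpq : p ≠ q) (hpr : p ≠ r) (hqr : q ≠ r) (ha : a ≠ 0) (hb : b ≠ 0) (hc : c ≠ 0) (hN : N = p ^ a * q ^ b * r ^ c) :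
    (Nat.card {χ : DirichletCharacter ℂ N // χ.Odd ∧ bernoulliOneChar χ = 0} : ℚ) /
        Nat.card {χ : DirichletCharacter ℂ N // χ.Odd} < 3 / 20 := by
  have hN2 : 2 < N := by
    rw [hN]
    calc 2 < 5 := by norm_num
      _ ≤ p := hp5
      _ = p ^ 1 := (pow_one p).symm
      _ ≤ p ^ a := Nat.pow_le_pow_right (by omega) (Nat.one_le_iff_ne_zero.2 ha)
      _ ≤ p ^ a * q ^ b := Nat.le_mul_of_pos_right _ (pow_pos hq.pos b)
      _ ≤ p ^ a * q ^ b * r ^ c := Nat.le_mul_of_pos_right _ (pow_pos hr.pos c)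
  have hS := two_mul_card_odd_eq_totient' (M := N) hN2
  have h := forty_mul_card_bad_lt_three_primes hp hq hr hp5 hq5 hr5 hpq hpr hqr ha hb hc hN
  have hSpos : 0 < Nat.card {χ : DirichletCharacter ℂ N // χ.Odd} := by
    have := Nat.totient_pos.2 (NeZero.pos N)
    omega
  rw [div_lt_div_iff₀ (by exact_mod_cast hSpos) (by norm_num)]
  have h' : (40 : ℚ) * Nat.card {χ : DirichletCharacter ℂ N // χ.Odd ∧ bernoulliOneChar χ = 0} <
      3 * (2 * Nat.card {χ : DirichletCharacter ℂ N // χ.Odd}) := by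
    rw [show (3 : ℚ) * (2 * Nat.card {χ : DirichletCharacter ℂ N // χ.Odd}) = 3 * ((2 * Nat.card {χ : DirichletCharacter ℂ N // χ.Odd} : ℕ) : ℚ)
      by push_cast; ring, hS]
    exact_mod_cast h
  linarith

/-- **`s(N) < s(55)` at three-prime levels**: the maximum `3/20` of Remark 1 is NOT attained at any `N = pᵃqᵇrᶜ`.
[cite: KoblitzRohrlich1978, §2 Remark 1 (p. 1192)] -/
theorem s_lt_s_fiftyFive_three_primes (hp : p.Prime) (hq : q.Prime) (hr : r.Prime) (hp5 : 5 ≤ p) (hq5 : 5 ≤ q) (hr5 : 5 ≤ r)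
    (hpq : p ≠ q) (hpr : p ≠ r) (hqr : q ≠ r) (ha : a ≠ 0) (hb : b ≠ 0) (hc : c ≠ 0) (hN : N = p ^ a * q ^ b * r ^ c) :
    (Nat.card {χ : DirichletCharacter ℂ N // χ.Odd ∧ bernoulliOneChar χ = 0} : ℚ) /
        Nat.card {χ : DirichletCharacter ℂ N // χ.Odd} <
      (Nat.card {χ : DirichletCharacter ℂ 55 // χ.Odd ∧ bernoulliOneChar χ = 0} : ℚ) /
        Nat.card {χ : DirichletCharacter ℂ 55 // χ.Odd} := by
  rw [s_fiftyFive]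
  exact s_lt_three_div_twenty_three_primes hp hq hr hp5 hq5 hr5 hpq hpr hqr ha hb hc hN

/-- **`N = pᵃqᵇrᶜ ≠ 55`** (trivially: `55 = 5·11` has two prime factors) — so the three-prime levels are consistent with "attained only when
`N = 55`". [cite: KoblitzRohrlich1978, §2 Remark 1 (p. 1192)] -/
theorem ne_fiftyFive_three_primes (hp : p.Prime) (hq : q.Prime) (hr : r.Prime) (hp5 : 5 ≤ p) (hq5 : 5 ≤ q) (hr5 : 5 ≤ r)
    (hpq : p ≠ q) (hpr : p ≠ r) (hqr : q ≠ r) (ha : a ≠ 0) (hb : b ≠ 0) (hc : c ≠ 0) (hN : N = p ^ a * q ^ b * r ^ c) : N ≠ 55 := by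
  intro h55
  have h := forty_mul_card_bad_lt_three_primes hp hq hr hp5 hq5 hr5 hpq hpr hqr ha hb hc hN
  subst h55
  rw [forty_mul_card_bad_fiftyFive_eq] at h
  exact lt_irrefl _ h

end ThreePrimes

end CyclotomicFermatCMType

end Literature.AlgebraicGeometry.ComplexMultiplication
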